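import Mathlib
import HarnessLib
import Summits.Ventures.LatticeQCDFlow.Exactness.SphereLuscherMomentIdentity
import Literature.MathematicalPhysics.QuantumFieldTheory.Balaban1983to89.B10Eq24Cumulant

/-!
# The constants of Lüscher's recursion on the lattice of site spheres ARE the cumulants of the action: `k!·ċ_k = κ_{k+1}(−S)`, i.e. `ċ_k = (−1)^{k+1}κ_{k+1}(S)/k!`, for every `C²` Lüscher series and every `k`

HONEST FRAMING: exact (Metropolis-corrected) sampling algorithms for lattice gauge theory;
figures of merit are autocorrelation/cost numbers at stated couplings and volumes; no
continuum-physics claim.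

Venture `LatticeQCDFlow` (cell pub-lqcd), topic `Exactness`; FANOUT row 7 (`s0-cpn-null`).  NEW WORK
of the cell over the tree's `Exactness/SphereLuscherMomentIdentity.lean` (this leg: the moment
identity `Σ_{i≤k} ċ_i·m_{k−i}/(k−i)! = m_{k+1}/k!`) and the Literature support file
`Literature/MathematicalPhysics/QuantumFieldTheory/Balaban1983to89/B10Eq24Cumulant.lean` ([folklore]
calculus of the cumulant generating function of a bounded random variable: `nmoment`,
`truncExp V ν n = (d/dt)ⁿ log∫e^{tV}dν |₀`, the moment–cumulant recursion `nmoment_succ`) and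
Mathlib's `iteratedDeriv_comp_neg`; nothing else is cited.  Printed counterpart, NAMED ONLY:
M. Lüscher, Commun. Math. Phys. 293 (2010) 899, §4.2 eq. (4.9)–(4.10): `Ċ_t = (d/dt)ln⟨e^{−tS}⟩`, so
the constants of the series `Ċ_t = Σ_k t^k ċ_k` are, up to factorials, the CUMULANTS of `−S` under the
a-priori measure ("the field-independent term is physical").  The tree had `ċ₀ = −S₀`, `ċ₁ = Var_π̄(S)`
(GEN-8/11) and, on the gauge side, the moment identity (`TrivializingMaps/ConstantsCumulants.lean`);
the identification with the derivatives of `log mgf` at ALL orders is new on either side.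

## Content (`V = −S` on `(Ω, π̄)`, `κ_n(X) = truncExp X π̄ n = (log mgf X)⁽ⁿ⁾(0)`)

* `neg_action_aemeasurable_bounded`, `nmoment_neg_action_eq` (bookkeeping: `V` is bounded and
  measurable, `nmoment V π̄ j = ∫V^j dπ̄`);
* **`luscher_constant_mul_factorial_eq_truncExp`** — `k!·ċ_k = κ_{k+1}(−S)` for every `k`, by strong
  induction: the moment identity and the moment–cumulant recursion are the same triangular system;
  **`luscher_constant_eq_truncExp`** (`ċ_k = κ_{k+1}(−S)/k!`);
* `truncExp_neg_action_eq` (`κ_n(−S) = (−1)ⁿκ_n(S)`: `cgf(−S)(t) = cgf(S)(−t)`) and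
  **`luscher_constant_eq_truncExp_action`**: `ċ_k = (−1)^{k+1}κ_{k+1}(S)/k!` — `ċ₀ = −κ₁ = −∫S dπ̄`,
  `ċ₁ = κ₂ = Var_π̄(S)`, `ċ₂ = −κ₃/2`, `ċ₃ = κ₄/6`, ….
* **`luscher_constant_powerSeries`** (`Ċ·Z = dZ/dX` in `ℝ⟦X⟧`, `Z = Σ_j (m_j/j!)X^j` the moment series of
  `−S`) and **`luscher_constant_powerSeries_eq_logDeriv`** (`Ċ = Z′·Z⁻¹`: the formal logarithmic
  derivative — the constants depend on the action only through its moments under `π̄`).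

NOT CLAIMED: convergence of `Σ_k t^kċ_k` (i.e. analyticity radius statements for `log Z` are not
transferred to the series); closed forms of `κ_n(S)` for the E–S action beyond `n ≤ 2`; the rung.
-/

noncomputable section

namespace Summit.Ventures.LatticeQCDFlow.Exactness

open Function Set Metric MeasureTheory NormedSpace InnerProductSpace ProbabilityTheory
open Literature.MathematicalPhysics.QuantumFieldTheory.Balaban1983to89.B10Eq24Cumulant
open scoped RealInnerProductSpace Nat

variable {Λ : Type*} {E : Type*} [NormedAddCommGroup E] [InnerProductSpace ℝ E]
  [FiniteDimensional ℝ E] [MeasurableSpace E] [BorelSpace E] [Fintype Λ] [DecidableEq Λ] [Nontrivial E]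

/-! ## §3 The cumulant reading at all orders -/

section Cumulants

variable {S : (Λ → E) → ℝ} {St : ℕ → (Λ → E) → ℝ} {c : ℕ → ℝ}

omit [DecidableEq Λ] [Nontrivial E] in
/-- `V = −S` is a bounded, measurable random variable on `(Ω, π̄)` (continuity on a compact space). -/
theorem neg_action_aemeasurable_bounded (hS : Continuous S) :
    AEMeasurable (fun ω : Λ → sphere (0 : E) 1 => -S (fun m => (ω m : E)))
        (Measure.pi (fun _ : Λ => uniformSphere (volume : Measure E))) ∧
      ∃ B : ℝ, ∀ᵐ ω ∂Measure.pi (fun _ : Λ => uniformSphere (volume : Measure E)),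
        |(-S (fun m => ((ω : Λ → sphere (0 : E) 1) m : E)))| ≤ B := by
  have hc : Continuous fun ω : Λ → sphere (0 : E) 1 => -S (fun m => (ω m : E)) :=
    (hS.comp continuous_sphereConfig).neg
  obtain ⟨B, hB⟩ := isCompact_univ.exists_bound_of_continuousOn hc.continuousOn
  exact ⟨hc.aemeasurable, B, ae_of_all _ fun ω => by
    simpa only [Real.norm_eq_abs] using hB ω (mem_univ ω)⟩

omit [DecidableEq Λ] in
/-- Under the probability measure `π̄` the normalised moments are the raw ones: `nmoment V π̄ j = ∫V^j dπ̄`. -/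
theorem nmoment_neg_action_eq (S : (Λ → E) → ℝ) (j : ℕ) :
    nmoment (fun ω : Λ → sphere (0 : E) 1 => -S (fun m => (ω m : E)))
        (Measure.pi (fun _ : Λ => uniformSphere (volume : Measure E))) j =
      ∫ ω, (-S (fun m => ((ω : Λ → sphere (0 : E) 1) m : E))) ^ j
        ∂Measure.pi (fun _ : Λ => uniformSphere (volume : Measure E)) := by
  rw [nmoment, Measure.real, measure_univ, ENNReal.toReal_one, div_one]

/-- **THE CUMULANT READING AT ALL ORDERS: `k!·ċ_k = κ_{k+1}(−S)`.**  For every `C¹` action `S` on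
`Ω`, every `C²` Lüscher series `(S̃⁽ᵏ⁾, ċ_k)` of `S` and every `k`, `k!` times the order-`k` constant is
the `(k+1)`-st cumulant `truncExp (−S) π̄ (k+1) = (d/dt)^{k+1} log∫e^{−tS}dπ̄ |_{t=0}` of the action
under the a-priori measure — Lüscher's `Ċ_t = (d/dt)ln⟨e^{−tS}⟩` as an identity of Taylor coefficients
(strong induction: §2 and the moment–cumulant recursion determine the same triangular system). -/
theorem luscher_constant_mul_factorial_eq_truncExp (hS : ContDiff ℝ 1 S)
    (hSt : ∀ k, ContDiff ℝ 2 (St k))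
    (h0 : ∀ ξ : Λ → sphere (0 : E) 1,
      -∑ n, siteLaplacian n (St 0) (fun m => (ξ m : E)) = S (fun m => (ξ m : E)) + c 0)
    (hs : ∀ k, ∀ ξ : Λ → sphere (0 : E) 1,
      -∑ n, siteLaplacian n (St (k + 1)) (fun m => (ξ m : E)) =
        -(∑ n, ⟪siteGrad n S (fun m => (ξ m : E)), siteGrad n (St k) (fun m => (ξ m : E))⟫) +
          c (k + 1)) (k : ℕ) :
    (k ! : ℝ) * c k = truncExp (fun ω : Λ → sphere (0 : E) 1 => -S (fun m => (ω m : E)))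
      (Measure.pi (fun _ : Λ => uniformSphere (volume : Measure E))) (k + 1) := by
  obtain ⟨hV, B, hB⟩ := neg_action_aemeasurable_bounded (Λ := Λ) (E := E) hS.continuous
  induction k using Nat.strong_induction_on with
  | _ k ih =>
    -- the two recursions for `m_{k+1}`
    have hM := nmoment_succ hV hB k
    have hL := luscher_constant_moment_identity hS hSt h0 hs k
    simp_rw [nmoment_neg_action_eq] at hM
    -- `m_{k+1} = Σ_i C(k,i)·(i!ċ_i)·m_{k−i}` from §2
    have hL' : ∫ ω, (-S (fun m => ((ω : Λ → sphere (0 : E) 1) m : E))) ^ (k + 1)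
        ∂Measure.pi (fun _ : Λ => uniformSphere (volume : Measure E)) =
        ∑ i ∈ Finset.range (k + 1), (k.choose i : ℝ) * ((i ! : ℝ) * c i) *
          ∫ ω, (-S (fun m => ((ω : Λ → sphere (0 : E) 1) m : E))) ^ (k - i)
            ∂Measure.pi (fun _ : Λ => uniformSphere (volume : Measure E)) := by
      have hk : (k ! : ℝ) ≠ 0 := by positivity
      rw [eq_div_iff hk] at hL
      rw [← hL, Finset.sum_mul]
      refine Finset.sum_congr rfl fun i hi => ?_
      have hik : i ≤ k := Nat.lt_succ_iff.1 (Finset.mem_range.1 hi)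
      have hchoose : (k.choose i : ℝ) * (i ! : ℝ) * ((k - i)! : ℝ) = (k ! : ℝ) := by
        exact_mod_cast Nat.choose_mul_factorial_mul_factorial hik
      have hki : ((k - i)! : ℝ) ≠ 0 := by positivity
      rw [div_mul_eq_mul_div, div_eq_iff hki, ← hchoose]
      ring
    rw [hL', Finset.sum_range_succ, Finset.sum_range_succ] at hM
    have hrest : ∑ i ∈ Finset.range k, (k.choose i : ℝ) * ((i ! : ℝ) * c i) *
          ∫ ω, (-S (fun m => ((ω : Λ → sphere (0 : E) 1) m : E))) ^ (k - i)
            ∂Measure.pi (fun _ : Λ => uniformSphere (volume : Measure E)) =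
        ∑ i ∈ Finset.range k, (k.choose i : ℝ) *
          truncExp (fun ω : Λ → sphere (0 : E) 1 => -S (fun m => (ω m : E)))
            (Measure.pi (fun _ : Λ => uniformSphere (volume : Measure E))) (i + 1) *
          ∫ ω, (-S (fun m => ((ω : Λ → sphere (0 : E) 1) m : E))) ^ (k - i)
            ∂Measure.pi (fun _ : Λ => uniformSphere (volume : Measure E)) :=
      Finset.sum_congr rfl fun i hi => by rw [ih i (Finset.mem_range.1 hi)]
    rw [hrest] at hM
    simp only [Nat.choose_self, Nat.sub_self, pow_zero, Nat.cast_one, one_mul, integral_const,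
      smul_eq_mul, mul_one, Measure.real, measure_univ, ENNReal.toReal_one] at hM
    linarith

/-- **`ċ_k = κ_{k+1}(−S)/k!`**: the constants of every `C²` Lüscher series of a `C¹` action on the
lattice of site spheres are the cumulants of `−S` under `π̄`, divided by factorials. -/
theorem luscher_constant_eq_truncExp (hS : ContDiff ℝ 1 S) (hSt : ∀ k, ContDiff ℝ 2 (St k))
    (h0 : ∀ ξ : Λ → sphere (0 : E) 1,
      -∑ n, siteLaplacian n (St 0) (fun m => (ξ m : E)) = S (fun m => (ξ m : E)) + c 0)
    (hs : ∀ k, ∀ ξ : Λ → sphere (0 : E) 1,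
      -∑ n, siteLaplacian n (St (k + 1)) (fun m => (ξ m : E)) =
        -(∑ n, ⟪siteGrad n S (fun m => (ξ m : E)), siteGrad n (St k) (fun m => (ξ m : E))⟫) +
          c (k + 1)) (k : ℕ) :
    c k = truncExp (fun ω : Λ → sphere (0 : E) 1 => -S (fun m => (ω m : E)))
      (Measure.pi (fun _ : Λ => uniformSphere (volume : Measure E))) (k + 1) / (k ! : ℝ) := by
  have hk : (k ! : ℝ) ≠ 0 := by positivity
  rw [eq_div_iff hk, mul_comm]
  exact luscher_constant_mul_factorial_eq_truncExp hS hSt h0 hs k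

omit [DecidableEq Λ] [Nontrivial E] in
/-- `cgf(−S)(t) = cgf(S)(−t)`, hence `κ_n(−S) = (−1)ⁿκ_n(S)` for the Taylor coefficients at `0`. -/
theorem truncExp_neg_action_eq (S : (Λ → E) → ℝ) (n : ℕ) :
    truncExp (fun ω : Λ → sphere (0 : E) 1 => -S (fun m => (ω m : E)))
        (Measure.pi (fun _ : Λ => uniformSphere (volume : Measure E))) n =
      (-1) ^ n * truncExp (fun ω : Λ → sphere (0 : E) 1 => S (fun m => (ω m : E)))
        (Measure.pi (fun _ : Λ => uniformSphere (volume : Measure E))) n := by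
  have hfun : cgf (fun ω : Λ → sphere (0 : E) 1 => -S (fun m => (ω m : E)))
      (Measure.pi (fun _ : Λ => uniformSphere (volume : Measure E))) =
      fun t => cgf (fun ω : Λ → sphere (0 : E) 1 => S (fun m => (ω m : E)))
        (Measure.pi (fun _ : Λ => uniformSphere (volume : Measure E))) (-t) := by
    funext t
    simp only [cgf, mgf, mul_neg, neg_mul]
  rw [truncExp, truncExp, hfun, iteratedDeriv_comp_neg, neg_zero, smul_eq_mul]

/-- **`ċ_k = (−1)^{k+1}κ_{k+1}(S)/k!`** — the constants in terms of the cumulants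
`κ_n(S) = (d/dt)ⁿ log∫e^{tS}dπ̄ |₀` of the action itself (`ċ₀ = −κ₁ = −∫S`, `ċ₁ = κ₂ = Var_π̄(S)`,
`ċ₂ = −κ₃/2`, `ċ₃ = κ₄/6`, …). -/
theorem luscher_constant_eq_truncExp_action (hS : ContDiff ℝ 1 S) (hSt : ∀ k, ContDiff ℝ 2 (St k))
    (h0 : ∀ ξ : Λ → sphere (0 : E) 1,
      -∑ n, siteLaplacian n (St 0) (fun m => (ξ m : E)) = S (fun m => (ξ m : E)) + c 0)
    (hs : ∀ k, ∀ ξ : Λ → sphere (0 : E) 1,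
      -∑ n, siteLaplacian n (St (k + 1)) (fun m => (ξ m : E)) =
        -(∑ n, ⟪siteGrad n S (fun m => (ξ m : E)), siteGrad n (St k) (fun m => (ξ m : E))⟫) +
          c (k + 1)) (k : ℕ) :
    c k = (-1) ^ (k + 1) * truncExp (fun ω : Λ → sphere (0 : E) 1 => S (fun m => (ω m : E)))
      (Measure.pi (fun _ : Λ => uniformSphere (volume : Measure E))) (k + 1) / (k ! : ℝ) := by
  rw [luscher_constant_eq_truncExp hS hSt h0 hs k, truncExp_neg_action_eq]


/-! ## `Ċ·Z = Z′` as formal power series -/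

/-- **`Ċ·Z = Z′` IN `ℝ⟦X⟧`** (Lüscher's (4.9) as an identity of formal power series): with
`Z = Σ_j (m_j/j!)X^j` the exponential generating series of the moments `m_j = ∫(−S)^j dπ̄` (the Taylor
series of `∫e^{−tS}dπ̄`) and `Ċ = Σ_k ċ_k X^k`, `Ċ·Z = dZ/dX`, for every `C²` Lüscher series of a
`C¹` action on the lattice of site spheres. -/
theorem luscher_constant_powerSeries (hS : ContDiff ℝ 1 S) (hSt : ∀ k, ContDiff ℝ 2 (St k))
    (h0 : ∀ ξ : Λ → sphere (0 : E) 1,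
      -∑ n, siteLaplacian n (St 0) (fun m => (ξ m : E)) = S (fun m => (ξ m : E)) + c 0)
    (hs : ∀ k, ∀ ξ : Λ → sphere (0 : E) 1,
      -∑ n, siteLaplacian n (St (k + 1)) (fun m => (ξ m : E)) =
        -(∑ n, ⟪siteGrad n S (fun m => (ξ m : E)), siteGrad n (St k) (fun m => (ξ m : E))⟫) +
          c (k + 1)) :
    PowerSeries.mk c * PowerSeries.mk (fun j => (∫ ω, (-S (fun m => ((ω : Λ → sphere (0 : E) 1) m : E))) ^ j
        ∂Measure.pi (fun _ : Λ => uniformSphere (volume : Measure E))) / (j ! : ℝ)) =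
      PowerSeries.derivative ℝ (PowerSeries.mk fun j =>
        (∫ ω, (-S (fun m => ((ω : Λ → sphere (0 : E) 1) m : E))) ^ j
          ∂Measure.pi (fun _ : Λ => uniformSphere (volume : Measure E))) / (j ! : ℝ)) := by
  ext k
  rw [PowerSeries.coeff_mul, PowerSeries.coeff_derivative, PowerSeries.coeff_mk,
    Finset.Nat.sum_antidiagonal_eq_sum_range_succ_mk, Nat.succ_eq_add_one]
  simp only [PowerSeries.coeff_mk]
  have h := luscher_constant_moment_identity hS hSt h0 hs k
  have hsum : ∑ i ∈ Finset.range (k + 1), c i *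
      ((∫ ω, (-S (fun m => ((ω : Λ → sphere (0 : E) 1) m : E))) ^ (k - i)
        ∂Measure.pi (fun _ : Λ => uniformSphere (volume : Measure E))) / ((k - i)! : ℝ)) =
      ∑ i ∈ Finset.range (k + 1), c i *
        (∫ ω, (-S (fun m => ((ω : Λ → sphere (0 : E) 1) m : E))) ^ (k - i)
          ∂Measure.pi (fun _ : Λ => uniformSphere (volume : Measure E))) / ((k - i)! : ℝ) :=
    Finset.sum_congr rfl fun i _ => by ring
  rw [hsum, h, Nat.factorial_succ]
  have hk : (k ! : ℝ) ≠ 0 := by positivity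
  have hk1 : ((k : ℝ) + 1) ≠ 0 := by positivity
  push_cast
  field_simp

omit [DecidableEq Λ] in
/-- The moment series `Z` has constant coefficient `m₀ = 1`, so it is invertible in `ℝ⟦X⟧`. -/
theorem constantCoeff_momentSeries (S : (Λ → E) → ℝ) :
    PowerSeries.constantCoeff (PowerSeries.mk fun j =>
        (∫ ω, (-S (fun m => ((ω : Λ → sphere (0 : E) 1) m : E))) ^ j
          ∂Measure.pi (fun _ : Λ => uniformSphere (volume : Measure E))) / (j ! : ℝ)) = 1 := by
  rw [← PowerSeries.coeff_zero_eq_constantCoeff_apply, PowerSeries.coeff_mk]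
  simp only [pow_zero, Nat.factorial_zero, Nat.cast_one, div_one, integral_const, smul_eq_mul,
    mul_one, Measure.real, measure_univ, ENNReal.toReal_one]

/-- **`Ċ = Z′·Z⁻¹` in `ℝ⟦X⟧`**: the constants of every `C²` Lüscher series are the coefficients of the
formal logarithmic derivative of the moment series `Z` of `−S` under `π̄` — determined by the moments
of the action alone, independently of the series. -/
theorem luscher_constant_powerSeries_eq_logDeriv (hS : ContDiff ℝ 1 S)
    (hSt : ∀ k, ContDiff ℝ 2 (St k))
    (h0 : ∀ ξ : Λ → sphere (0 : E) 1,
      -∑ n, siteLaplacian n (St 0) (fun m => (ξ m : E)) = S (fun m => (ξ m : E)) + c 0)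
    (hs : ∀ k, ∀ ξ : Λ → sphere (0 : E) 1,
      -∑ n, siteLaplacian n (St (k + 1)) (fun m => (ξ m : E)) =
        -(∑ n, ⟪siteGrad n S (fun m => (ξ m : E)), siteGrad n (St k) (fun m => (ξ m : E))⟫) +
          c (k + 1)) :
    PowerSeries.mk c =
      PowerSeries.derivative ℝ (PowerSeries.mk fun j =>
          (∫ ω, (-S (fun m => ((ω : Λ → sphere (0 : E) 1) m : E))) ^ j
            ∂Measure.pi (fun _ : Λ => uniformSphere (volume : Measure E))) / (j ! : ℝ)) *
        (PowerSeries.mk fun j =>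
          (∫ ω, (-S (fun m => ((ω : Λ → sphere (0 : E) 1) m : E))) ^ j
            ∂Measure.pi (fun _ : Λ => uniformSphere (volume : Measure E))) / (j ! : ℝ))⁻¹ := by
  rw [← luscher_constant_powerSeries hS hSt h0 hs, mul_assoc, PowerSeries.mul_inv_cancel _
    (by rw [constantCoeff_momentSeries]; exact one_ne_zero), mul_one]

end Cumulants

end Summit.Ventures.LatticeQCDFlow.Exactness

end
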